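import Summits.ResolutionOfSingularities.ResolutionOfSingularities.Theorems.MarkedTransferCampaignW31UscAssembly
import Summits.ResolutionOfSingularities.ResolutionOfSingularities.Theorems.MarkedTransferCampaignW31EdgeHilbLscProof
import HarnessLib

/-!
# [OURS · L1 W3.1] The slot statement «u.s.c. of `ξ ↦ Inv_ξ(E)`» needs NO finiteness input: a FINITE-DEGREE form of the
# combinatorial core, and `CampaignW31UscInvOneExponentI p` / `CampaignW31UscInvHypersurfaceI p` from the DICTIONARY ALONE

Cell `res-hironaka` (run/shared/lean/pub/res-hironaka/), rung L (rescue) of LADDER-RESOLUTION, slot W3.1 «u.s.c. first»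
(positive rung, verdict-free), seat res-L1-s31-pv-1 (hypersurface rung). Host (custody, no new route) = the EXISTING crux
`Theses.MarkedTransfer.HypersurfaceOrderReduction` (stmt-ResolutionOfSingularities-16155, `--supports … --as helper`), as the
statement files `Theorems/MarkedTransferCampaignW31UscInvOneExponent.lean` (p461513/p463247) and `…EdgeHilbertLsc.lean`
(p464862) and the assembly `…UscAssembly.lean` (p467881) it refines.

HONEST FRAMING. NOTHING here is a statement of H. Hironaka's manuscript *Resolution of singularities in positive
characteristics* (2017-03-23, [Hironaka2017], lit key `paper:url-3343fd9e678b`) and nothing here asserts that any statement of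
that manuscript holds. Every theorem below is elementary counting / point-set topology / pure logic over OUR typed carriers and
the tree's kernel-checked combinatorics (`Literature/AlgebraicGeometry/Hironaka2017/EdgeHilbert.lean`); no FACT-LIST premise and
no typed candidate of the manuscript is consumed. AI-produced kernel bookkeeping, weaker than expert review as to MEANING.

## What is proved, and why it matters for the slot

The assembly p467881 (`campaignW31UscInvOneExponentI_of_edgeHilb`) closes the slot statement from THREE inputs: (i) lower
semicontinuity of each `ξ ↦ dim G(ξ)_a` (`CampaignW31EdgeHilbLsc p` — PROVED in the kernel, `CampaignW31EdgeHilbLsc_holds`,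
p473940 + `…EdgeHilbLscProof.lean`), (ii) the dictionary `dim G(ξ)_a = N(q(D); a)` (`CampaignW31EdgeHilbDictionary p`), and
(iii) «only finitely many Hilbert functions occur» (`CampaignW31EdgeHilbFiniteRange p`, whose intended proof consumes the finite
generation of `℘(E)`, FACT-LIST F-21f / typed `U16_1`). Input (iii) is used in p467881 only to pass from «domination in each
degree separately near `ξ₀`» (one semicontinuity condition per degree) to «domination in EVERY degree near `ξ₀`».

This file shows that (iii) is NOT NEEDED: Hilbert-function domination in the finitely many degrees `a ≤ B`, with a bound
`B = (Σq+1)^{r−1}·Σq` depending only on the edge exponents `q = q(ξ₀)` AT `ξ₀`, already forces `Inv_ξ ≤lex Inv_{ξ₀}`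
(`CampaignW31.key_le_of_hilb_le_upTo`, the finite-degree form of the tree's `Datum.EdgeInv.key_le_of_hilb_le`: the growth
comparison `(t+1)^r ≤ #cum ≤ (tΣq+1)^k` of `EdgeHilbert.length_le_of_hilb_le` reads the Hilbert functions only up to degree
`t·Σq`, `t = (Σq+1)^{r−1}`, and the first-difference step `le_of_hilb_le_of_prefix_eq` only in degree `q_i ≤ Σq`). Hence:

* `CampaignW31.uscOn_selInv_of_lsc_of_dictionary` — THE ASSEMBLY at one ideal exponent from (i) + (ii) only;
* `campaignW31UscInvOneExponentI_of_lsc_of_dictionary` — `CampaignW31EdgeHilbLsc p → CampaignW31EdgeHilbDictionary p →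
  CampaignW31UscInvOneExponentI p`;
* `campaignW31UscInvOneExponentI_of_dictionary` — with (i) discharged by `CampaignW31EdgeHilbLsc_holds`: THE SLOT STATEMENT
  FOLLOWS FROM THE DICTIONARY ALONE, `CampaignW31EdgeHilbDictionary p → CampaignW31UscInvOneExponentI p`; its hypersurface rung
  `campaignW31UscInvHypersurfaceI_of_dictionary` (seat pv-1's named target `CampaignW31UscInvHypersurfaceI p`), the parametric
  forms at row 005 part b's provenance (`campaignW31UscInvOneExponent_of_dictionary`, `campaignW31UscInvHypersurface_of_dictionary`)
  and the two p.30 consequences (`campaignW31InvmaxClosedI_of_dictionary`).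

So the finite generation of `℘(E)` (F-21f / `U16_1`) drops out of the u.s.c. rung entirely; what the rung still consumes is
exactly the dictionary (ii), i.e. the structure `G(ξ) = κ[ℓ_1^{q_1}, …, ℓ_r^{q_r}]` of the edge algebra at each closed singular
point (seats res-L1-s31-pv-2/pv-3).

## References (context only; nothing below is a premise)

* H. Hironaka, ms. 2017-03-23, Eq. (34) p.24 l.29–31; §6.2 p.30 l.4–8; p.86 l.7–10. [Hironaka2017]
* V. Cossart, U. Jannsen, S. Saito, LNM 2270 (2020), Lemma 2.34 (pattern only). [CossartJannsenSaito2020]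
-/

set_option linter.dupNamespace false -- mandated namespace of this single-conjunct summit

open _root_.AlgebraicGeometry _root_.TopologicalSpace _root_.Topology _root_.Filter Set

namespace Summit.ResolutionOfSingularities.ResolutionOfSingularities.Theorems

open Literature.AlgebraicGeometry.Resolution
open Literature.AlgebraicGeometry.Hironaka2017
open Literature.AlgebraicGeometry.Hironaka2017.S02Preliminaries
open Literature.AlgebraicGeometry.Hironaka2017.S04CharAlgebra
open Literature.AlgebraicGeometry.Hironaka2017.Datum
open Literature.AlgebraicGeometry.Hironaka2017.EdgeHilbert

universe u

namespace CampaignW31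

/-! ## Finite-degree combinatorics: Hilbert-function domination up to a bound -/

section Combinatorics

open Finset

variable {r k : ℕ}

/-- Domination of Hilbert functions in degrees `a ≤ A` integrates to domination of the cumulative counts `#cum · A`
(finite-degree form of the tree's `EdgeHilbert.card_cum_le_card_cum`). [folklore] -/
theorem card_cum_le_card_cum_upTo {q : Fin r → ℕ} {s : Fin k → ℕ} (hq : ∀ i, 1 ≤ q i) (hs : ∀ i, 1 ≤ s i)
    (A : ℕ) (h : ∀ a ≤ A, hilb q a ≤ hilb s a) : (cum q A).card ≤ (cum s A).card := by
  rw [card_cum q hq, card_cum s hs]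
  exact Finset.sum_le_sum fun a ha => h a (Nat.lt_succ_iff.mp (Finset.mem_range.mp ha))

/-- Every exponent lies below the GROWTH BOUND `(Σq+1)^{r−1}·Σq` — the degree up to which the growth comparison of
`EdgeHilbert.length_le_of_hilb_le` reads the Hilbert functions (a function of the exponents `q` of the SMALLER algebra only;
written out in full everywhere below, no abbreviation is introduced): `q_i ≤ Σ q ≤ (Σq+1)^{r−1} Σ q`. [folklore] -/
theorem le_growthBound (q : Fin r → ℕ) (i : Fin r) : q i ≤ ((∑ j, q j) + 1) ^ (r - 1) * ∑ j, q j := by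
  have h1 : q i ≤ ∑ j, q j := Finset.single_le_sum (f := q) (fun j _ => Nat.zero_le (q j)) (Finset.mem_univ i)
  have h2 : 1 ≤ ((∑ j, q j) + 1) ^ (r - 1) := Nat.one_le_pow _ _ (Nat.succ_pos _)
  calc q i ≤ ∑ j, q j := h1
    _ = 1 * ∑ j, q j := (one_mul _).symm
    _ ≤ ((∑ j, q j) + 1) ^ (r - 1) * ∑ j, q j := Nat.mul_le_mul_right _ h2

/-- **Finite-degree form of `EdgeHilbert.length_le_of_hilb_le`.** If the Hilbert function of `κ[ℓ^{s}]` (`k` generators)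
dominates that of `κ[ℓ^{q}]` (`r` generators) in every degree `a ≤ (Σq+1)^{r−1}·Σq`, then `r ≤ k`. Same growth argument as in
the tree (`(t+1)^r ≤ #cum q (tΣq) ≤ #cum s (tΣq) ≤ (tΣq+1)^k`, `t = (Σq+1)^{r−1}`), which never looks beyond degree `tΣq`.
[folklore] -/
theorem length_le_of_hilb_le_upTo {q : Fin r → ℕ} {s : Fin k → ℕ} (hq : ∀ i, 1 ≤ q i) (hs : ∀ i, 1 ≤ s i)
    (h : ∀ a ≤ ((∑ i, q i) + 1) ^ (r - 1) * ∑ i, q i, hilb q a ≤ hilb s a) : r ≤ k := by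
  by_contra hlt
  push Not at hlt
  have hr : 1 ≤ r := by omega
  set S := ∑ i, q i with hS
  have hS1 : 1 ≤ S := by
    have : q ⟨0, by omega⟩ ≤ ∑ i, q i :=
      Finset.single_le_sum (f := q) (fun i _ => Nat.zero_le (q i)) (Finset.mem_univ _)
    have h0 := hq ⟨0, by omega⟩
    omega
  set t := (S + 1) ^ (r - 1) with ht
  have ht1 : 1 ≤ t := Nat.one_le_pow _ _ (by omega)
  have h1 : (t + 1) ^ r ≤ (t * S + 1) ^ k :=
    (pow_le_card_cum q hq t).trans ((card_cum_le_card_cum_upTo hq hs (t * S) h).trans (card_cum_le s _))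
  have h2 : (t * S + 1) ^ k ≤ (t * S + 1) ^ (r - 1) := Nat.pow_le_pow_right (by omega) (by omega)
  have h3 : (t * S + 1) ^ (r - 1) ≤ (t * (S + 1)) ^ (r - 1) := by
    apply Nat.pow_le_pow_left
    rw [mul_add, mul_one]
    exact Nat.add_le_add_left ht1 _
  have h4 : (t * (S + 1)) ^ (r - 1) = t ^ r := by
    rw [mul_pow, ← ht, ← pow_succ, Nat.sub_add_cancel hr]
  have h5 : t ^ r < (t + 1) ^ r := Nat.pow_lt_pow_left (Nat.lt_succ_self t) (by omega)
  have : (t + 1) ^ r < (t + 1) ^ r :=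
    calc (t + 1) ^ r ≤ (t * S + 1) ^ k := h1
      _ ≤ (t * S + 1) ^ (r - 1) := h2
      _ ≤ (t * (S + 1)) ^ (r - 1) := h3
      _ = t ^ r := h4
      _ < (t + 1) ^ r := h5
  exact lt_irrefl _ this

/-- **Single-degree form of `EdgeHilbert.le_of_hilb_le_of_prefix_eq`.** With the same number of generators, `s` sorted and
`hilb q (q_i) ≤ hilb s (q_i)` in the ONE degree `q_i`: if `q` and `s` agree before index `i`, then `s_i ≤ q_i`. [folklore] -/
theorem le_of_hilb_le_of_prefix_eq_at {q s : Fin r → ℕ} (hq : ∀ i, 1 ≤ q i) (hs : ∀ i, 1 ≤ s i)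
    (hsm : Monotone s) (i : Fin r) (h : hilb q (q i) ≤ hilb s (q i))
    (hpre : ∀ j, j < i → s j = q j) : s i ≤ q i := by
  by_contra hlt
  push Not at hlt
  have hsub : sol s (q i) ⊆ sol q (q i) := by
    intro m hm
    rw [mem_sol hs] at hm
    rw [mem_sol hq, ← hm]
    apply Finset.sum_congr rfl
    intro j _
    by_cases hj : j < i
    · rw [hpre j hj]
    · have hsj : q i < s j := lt_of_lt_of_le hlt (hsm (not_lt.mp hj))
      have hmj : m j * s j ≤ q i := by
        rw [← hm]
        exact Finset.single_le_sum (f := fun j => m j * s j) (fun j _ => Nat.zero_le _) (Finset.mem_univ j)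
      have hm0 : m j = 0 := by
        by_contra hne
        have h1 : 1 ≤ m j := Nat.one_le_iff_ne_zero.mpr hne
        have h2 : s j ≤ m j * s j := Nat.le_mul_of_pos_left _ h1
        omega
      simp [hm0]
  have hmem : (fun j => if j = i then 1 else 0) ∈ sol q (q i) := by
    rw [mem_sol hq, sum_unitVec_mul]
  have hnmem : (fun j => if j = i then 1 else 0) ∉ sol s (q i) := by
    rw [mem_sol hs, sum_unitVec_mul]
    exact ne_of_gt hlt
  have hlt' : hilb s (q i) < hilb q (q i) :=
    Finset.card_lt_card ((Finset.ssubset_iff_of_subset hsub).mpr ⟨_, hmem, hnmem⟩)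
  exact absurd h (not_le.mpr hlt')

end Combinatorics

/-! ## Finite-degree form of the combinatorial core on the padded keys of `Datum.EdgeInv` -/

/-- **UPPER SEMICONTINUITY OF `Inv`, combinatorial core, FINITE-DEGREE FORM** (refines the tree's
`Datum.EdgeInv.key_le_of_hilb_le`): if the Hilbert function `N(w.q; ·)` (exponents sorted, as in Def. 4.11 p.21) dominates
`N(v.q; ·)` in every degree `a ≤ B(v) := (Σq+1)^{r−1}·Σq` (the DEGREE BOUND of `v = (n, n − r, q_1, …, q_r)`, `q = v.expo`), then
`w ≤lex v` for the padded keys of Eq. (34) p.24 / Th. 16.6 (2) p.84. Proof = the tree's proof with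
`length_le_of_hilb_le_upTo` / `le_of_hilb_le_of_prefix_eq_at` in place of their all-degree forms (the degree `q_i` used in the
second step is `≤ B(v)` by `le_growthBound`). [folklore] -/
theorem key_le_of_hilb_le_upTo {n : ℕ} (v w : EdgeInv n) (hw : w.q.Pairwise (· ≤ ·))
    (h : ∀ a ≤ ((∑ i, v.expo i) + 1) ^ (v.q.length - 1) * ∑ i, v.expo i, hilb v.expo a ≤ hilb w.expo a) :
    w.key ≤ v.key := by
  have hq1 : ∀ i : Fin v.q.length, 1 ≤ v.expo i := fun i => v.one_le _ (List.get_mem _ _)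
  have hs1 : ∀ i : Fin w.q.length, 1 ≤ w.expo i := fun i => w.one_le _ (List.get_mem _ _)
  have hlen : v.q.length ≤ w.q.length := length_le_of_hilb_le_upTo hq1 hs1 h
  rcases hlen.eq_or_lt with heq | hlt
  swap
  · exact le_of_lt (EdgeInv.key_lt_of_length_lt v w hlt)
  by_contra hnot
  have hvw : v.key < w.key := not_le.mp hnot
  obtain ⟨i, hpre, hi⟩ := hvw
  simp only [EdgeInv.key, Pi.toLex_apply] at hpre hi
  obtain ⟨i, hin⟩ := i
  rcases i with _ | _ | t
  · simp at hi
  · simp [EdgeInv.r, heq] at hi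
  · have e0 : ¬ (t + 1 + 1 = 0) := by omega
    have e1 : ¬ (t + 1 + 1 = 1) := by omega
    have e2 : t + 1 + 1 - 2 = t := by omega
    simp only [e0, e1, e2, if_false] at hi
    -- `hi : v.q.getD t 0 < w.q.getD t 0`
    by_cases ht : t < v.q.length
    swap
    · rw [List.getD_eq_default _ _ (not_lt.mp ht), List.getD_eq_default _ _ (by omega)] at hi
      exact lt_irrefl _ hi
    have htw : t < w.q.length := by omega
    -- the casted exponent function of `w`
    set s : Fin v.q.length → ℕ := fun j => w.expo (Fin.cast heq j) with hs_def
    have hs1' : ∀ j, 1 ≤ s j := fun j => hs1 _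
    have hsm : Monotone s := by
      intro a b hab
      have hab' : Fin.cast heq a ≤ Fin.cast heq b := by
        rw [Fin.le_def] at hab ⊢
        exact hab
      exact hw.rel_get_of_le hab'
    have h' : ∀ a ≤ ((∑ i, v.expo i) + 1) ^ (v.q.length - 1) * ∑ i, v.expo i, hilb v.expo a ≤ hilb s a := by
      intro a ha
      rw [hs_def, hilb_cast heq]
      exact h a ha
    have hpre' : ∀ j : Fin v.q.length, j < ⟨t, ht⟩ → s j = v.expo j := by
      intro j hj
      have hj' : j.val < t := hj
      have hjn : j.val + 2 < n + 2 := by omega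
      have e := hpre ⟨j.val + 2, hjn⟩ (by rw [Fin.lt_def]; exact Nat.add_lt_add_right hj' 2)
      have f0 : ¬ (j.val + 2 = 0) := by omega
      have f1 : ¬ (j.val + 2 = 1) := by omega
      have f2 : j.val + 2 - 2 = j.val := by omega
      simp only [f0, f1, f2, if_false] at e
      rw [List.getD_eq_getElem _ _ j.isLt, List.getD_eq_getElem _ _ (by omega)] at e
      simp only [hs_def, EdgeInv.expo, List.get_eq_getElem, Fin.val_cast]
      exact e.symm
    have hdeg : v.expo ⟨t, ht⟩ ≤ ((∑ i, v.expo i) + 1) ^ (v.q.length - 1) * ∑ i, v.expo i :=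
      le_growthBound v.expo ⟨t, ht⟩
    have hle := le_of_hilb_le_of_prefix_eq_at hq1 hs1' hsm ⟨t, ht⟩ (h' _ hdeg) hpre'
    rw [List.getD_eq_getElem _ _ ht, List.getD_eq_getElem _ _ htw] at hi
    simp only [hs_def, EdgeInv.expo, List.get_eq_getElem, Fin.val_cast] at hle
    omega

/-- The same in terms of Hironaka's order on `Inv` values: under Hilbert-function domination in degrees `≤ B(v)`, `Inv` does
not rise. [folklore] -/
theorem not_lt_of_hilb_le_upTo {n : ℕ} (v w : EdgeInv n) (hw : w.q.Pairwise (· ≤ ·))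
    (h : ∀ a ≤ ((∑ i, v.expo i) + 1) ^ (v.q.length - 1) * ∑ i, v.expo i, hilb v.expo a ≤ hilb w.expo a) : ¬ v < w :=
  not_lt_of_ge (key_le_of_hilb_le_upTo v w hw h)

/-! ## The assembly at one ideal exponent, without the finiteness input -/

variable {Z : Scheme.{u}} {p : ℕ} [Fact p.Prime] {n : ℕ} {E : IdealExponent Z}

/-- **Hilbert-function domination in degrees `≤ B(inv D₀)` forces `Inv` not to rise** (finite-degree form of p467881's
`CampaignW31.key_inv_le_of_hilb_le`, on row 007's values `inv D`; `B(v) = (Σq+1)^{r−1}·Σq` for `v = (n, n−r, q)`). [folklore] -/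
theorem key_inv_le_of_hilb_le_upTo {ξ₀ ξ : Z} (D₀ : EdgeDatumAt p n E ξ₀) (D : EdgeDatumAt p n E ξ)
    (h : ∀ a ≤ ((∑ i, (inv D₀).expo i) + 1) ^ ((inv D₀).q.length - 1) * ∑ i, (inv D₀).expo i,
      hilb (EdgeDatum.q D₀) a ≤ hilb (EdgeDatum.q D) a) :
    (inv D).key ≤ (inv D₀).key := by
  refine key_le_of_hilb_le_upTo (inv D₀) (inv D) (inv_q_pairwise D) fun a ha => ?_
  rw [hilb_expo_inv, hilb_expo_inv]
  exact h a ha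

/-- **[OURS · L1 W3.1] THE ASSEMBLY at one ideal exponent `E` on a scheme `Z`, WITHOUT input (iii).** Write
`S_cl = Sing(E) ∩ Z_cl` and `H(ξ)(a) = dim_{κ(ξ)} G(ξ)_a` (`CampaignW31.edgeHilbAt E ξ a`). Assume (i) for every degree `a`,
`ξ ↦ H(ξ)(a)` is LOWER semicontinuous on `S_cl`, and (ii) at every `ξ ∈ S_cl` and every edge data `D` with the provenance
`IsEdgeData`, `H(ξ)(a) = N(q(D); a)` for all `a`. Then for EVERY edge-data selection `sel` with that provenance, `ξ ↦ Inv_ξ(E)` read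
off `sel` (typed `selInv`) is upper semicontinuous on `S_cl` (typed `UscOn`). Proof: fix `ξ₀` with edge data `D₀`; the FINITELY
MANY semicontinuity conditions in degrees `a ≤ B(inv D₀)` give, near `ξ₀` within `S_cl`, `N(q(D_ξ); a) ≥ N(q(D₀); a)` for
all those `a` (by (ii) at `ξ₀` and at `ξ`), whence `Inv_ξ ≤lex Inv_{ξ₀}` by `key_inv_le_of_hilb_le_upTo`. Replaces nothing printed
(the manuscript offers no argument, GAP R13); NOT a statement of the manuscript. [folklore] -/
theorem uscOn_selInv_of_lsc_of_dictionary
    {IsEdgeData : ∀ ⦃X : Scheme.{u}⦄ ⦃p n : ℕ⦄ (E : IdealExponent X) (ξ : X), EdgeDatumAt p n E ξ → Prop}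
    (hlsc : ∀ a : ℕ, LowerSemicontinuousOn (fun ξ => edgeHilbAt E ξ a) (E.sing ∩ S02Preliminaries.closedPoints Z))
    (hdict : ∀ ξ ∈ E.sing ∩ S02Preliminaries.closedPoints Z, ∀ D : EdgeDatumAt p n E ξ,
      IsEdgeData E ξ D → ∀ a : ℕ, edgeHilbAt E ξ a = (hilb (EdgeDatum.q D) a : ℕ∞))
    (sel : EdgeDataSelection p n E IsEdgeData) : UscOn E.sing (selInv sel) := by
  set T : Set Z := E.sing ∩ S02Preliminaries.closedPoints Z with hT
  show UpperSemicontinuousOn (fun ξ => (selInv sel ξ).key) T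
  intro ξ₀ hξ₀ y hy
  have hξ₀' : ξ₀ ∈ E.sing ∩ S02Preliminaries.closedPoints Z := hξ₀
  set D₀ := sel.D ξ₀ hξ₀' with hD₀
  set B : ℕ := ((∑ i, (inv D₀).expo i) + 1) ^ ((inv D₀).q.length - 1) * ∑ i, (inv D₀).expo i with hB
  -- Step 1: near `ξ₀` within `T`, in every degree `a ≤ B`, `H ξ a ≥ N(q(D₀); a)`.
  have hdeg : ∀ i : Fin (B + 1), ∀ᶠ ξ in 𝓝[T] ξ₀, (hilb (EdgeDatum.q D₀) i : ℕ∞) ≤ edgeHilbAt E ξ i := by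
    intro i
    have e0 : edgeHilbAt E ξ₀ i = (hilb (EdgeDatum.q D₀) i : ℕ∞) :=
      hdict ξ₀ hξ₀' D₀ (sel.isEdgeData ξ₀ hξ₀') i
    rcases Nat.eq_zero_or_pos (hilb (EdgeDatum.q D₀) i) with hz | hpos
    · exact Eventually.of_forall fun ξ => by rw [hz, Nat.cast_zero]; exact bot_le
    · have hlt : ((hilb (EdgeDatum.q D₀) i - 1 : ℕ) : ℕ∞) < edgeHilbAt E ξ₀ i := by
        rw [e0]
        exact_mod_cast Nat.sub_lt hpos Nat.one_pos
      have hev : ∀ᶠ ξ in 𝓝[T] ξ₀, ((hilb (EdgeDatum.q D₀) i - 1 : ℕ) : ℕ∞) < edgeHilbAt E ξ i :=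
        hlsc i ξ₀ hξ₀ _ hlt
      refine hev.mono fun ξ hξ => ?_
      have h1 : ((hilb (EdgeDatum.q D₀) i - 1 : ℕ) : ℕ∞) + 1 ≤ edgeHilbAt E ξ i := Order.add_one_le_of_lt hξ
      have h3 : hilb (EdgeDatum.q D₀) i - 1 + 1 = hilb (EdgeDatum.q D₀) i := Nat.sub_add_cancel hpos
      have h2 : ((hilb (EdgeDatum.q D₀) i - 1 : ℕ) : ℕ∞) + 1 = (hilb (EdgeDatum.q D₀) i : ℕ∞) := by
        have h4 := congrArg (fun m : ℕ => (m : ℕ∞)) h3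
        simpa only [Nat.cast_add, Nat.cast_one] using h4
      exact h2 ▸ h1
  have hdom : ∀ᶠ ξ in 𝓝[T] ξ₀, ∀ i : Fin (B + 1), (hilb (EdgeDatum.q D₀) i : ℕ∞) ≤ edgeHilbAt E ξ i :=
    eventually_all.mpr hdeg
  -- Step 2: domination up to degree `B` gives `Inv_ξ ≤lex Inv_{ξ₀}`.
  filter_upwards [hdom, eventually_mem_nhdsWithin] with ξ hξ hξT
  have hξT' : ξ ∈ E.sing ∩ S02Preliminaries.closedPoints Z := hξT
  have h0 : selInv sel ξ₀ = inv D₀ := by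
    simp only [hD₀, selInv, dif_pos hξ₀']
  have h1 : selInv sel ξ = inv (sel.D ξ hξT') := by
    simp only [selInv, dif_pos hξT']
  have hle : (inv (sel.D ξ hξT')).key ≤ (inv D₀).key := by
    refine key_inv_le_of_hilb_le_upTo D₀ (sel.D ξ hξT') fun a ha => ?_
    have e1 := hdict ξ hξT' (sel.D ξ hξT') (sel.isEdgeData ξ hξT') a
    have hξa := hξ ⟨a, Nat.lt_succ_of_le ha⟩
    simp only [] at hξa
    rw [e1] at hξa
    exact_mod_cast hξa
  have hy' : (inv D₀).key < y := by
    rw [← h0]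
    exact hy
  show (selInv sel ξ).key < y
  rw [h1]
  exact lt_of_le_of_lt hle hy'

end CampaignW31

open CampaignW31

/-! ## Corollaries on the typed campaign statements -/

/-- **[OURS · L1 W3.1] THE SLOT STATEMENT FROM TWO EDGE-ALGEBRA INPUTS** (no finiteness): `CampaignW31EdgeHilbLsc p →
CampaignW31EdgeHilbDictionary p → CampaignW31UscInvOneExponentI p`. NOT a statement of the manuscript. [folklore] -/
theorem campaignW31UscInvOneExponentI_of_lsc_of_dictionary (p : ℕ) [Fact p.Prime]
    (hlsc : CampaignW31EdgeHilbLsc.{u} p) (hdict : CampaignW31EdgeHilbDictionary.{u} p) :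
    CampaignW31UscInvOneExponentI.{u} p :=
  fun K _ _ _ A n E hE sel => uscOn_selInv_of_lsc_of_dictionary (hlsc K A E hE) (hdict K A n E hE) sel

/-- **[OURS · L1 W3.1] THE SLOT STATEMENT FROM THE DICTIONARY ALONE**: input (i) is the kernel theorem
`CampaignW31EdgeHilbLsc_holds` (seat res-L1-s31-pv-2), input (iii) is not needed (this file), so
`CampaignW31EdgeHilbDictionary p → CampaignW31UscInvOneExponentI p`. NOT a statement of the manuscript. [folklore] -/
theorem campaignW31UscInvOneExponentI_of_dictionary (p : ℕ) [Fact p.Prime]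
    (hdict : CampaignW31EdgeHilbDictionary.{u} p) : CampaignW31UscInvOneExponentI.{u} p :=
  campaignW31UscInvOneExponentI_of_lsc_of_dictionary p (CampaignW31EdgeHilbLsc_holds.{u} p) hdict

/-- **[OURS · L1 W3.1] THE HYPERSURFACE RUNG FROM THE DICTIONARY ALONE** (seat res-L1-s31-pv-1's named target
`CampaignW31UscInvHypersurfaceI p`, `J` effective Cartier — the setting of the host crux
`Theses.MarkedTransfer.HypersurfaceOrderReduction` stmt-16155 and of K3.1's specimen): `CampaignW31EdgeHilbDictionary p →
CampaignW31UscInvHypersurfaceI p`. NOT a statement of the manuscript. [folklore] -/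
theorem campaignW31UscInvHypersurfaceI_of_dictionary (p : ℕ) [Fact p.Prime]
    (hdict : CampaignW31EdgeHilbDictionary.{u} p) : CampaignW31UscInvHypersurfaceI.{u} p :=
  campaignW31UscInvHypersurfaceI_of_oneExponentI p (campaignW31UscInvOneExponentI_of_dictionary p hdict)

/-- **[OURS · L1 W3.1] the two p.30 consequences FROM THE DICTIONARY ALONE** (`Inv_max` attained, `Inv_max`-stratum closed;
p467881 `campaignW31InvmaxClosedI_of_uscInvOneExponentI`). NOT a statement of the manuscript. [folklore] -/
theorem campaignW31InvmaxClosedI_of_dictionary (p : ℕ) [Fact p.Prime]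
    (hdict : CampaignW31EdgeHilbDictionary.{u} p) : CampaignW31InvmaxClosedI.{u} p :=
  campaignW31InvmaxClosedI_of_uscInvOneExponentI p (campaignW31UscInvOneExponentI_of_dictionary p hdict)

/-- Pure logic: the parametric hypersurface rung at row 005 part b's provenance predicate is the conjunction over primes of
its parameter-free `p`-slices (same pattern as p463247's `campaignW31UscInvOneExponentI_iff`). [folklore] -/
theorem campaignW31UscInvHypersurfaceI_iff :
    CampaignW31UscInvHypersurface.{u} CampaignW31.edgeDataProvenance ↔
      ∀ (p : ℕ) [Fact p.Prime], CampaignW31UscInvHypersurfaceI.{u} p :=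
  Iff.rfl

/-- **[OURS · L1 W3.1]** parametric form: the dictionary at every prime gives the slot statement
`CampaignW31UscInvOneExponent` AT row 005 part b's provenance `CampaignW31.edgeDataProvenance`. NOT a statement of the
manuscript. [folklore] -/
theorem campaignW31UscInvOneExponent_of_dictionary
    (hdict : ∀ (p : ℕ) [Fact p.Prime], CampaignW31EdgeHilbDictionary.{u} p) :
    CampaignW31UscInvOneExponent.{u} CampaignW31.edgeDataProvenance :=
  campaignW31UscInvOneExponentI_iff.mpr fun p _ => campaignW31UscInvOneExponentI_of_dictionary p (hdict p)

/-- **[OURS · L1 W3.1]** parametric form of the hypersurface rung: the dictionary at every prime gives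
`CampaignW31UscInvHypersurface` AT row 005 part b's provenance. NOT a statement of the manuscript. [folklore] -/
theorem campaignW31UscInvHypersurface_of_dictionary
    (hdict : ∀ (p : ℕ) [Fact p.Prime], CampaignW31EdgeHilbDictionary.{u} p) :
    CampaignW31UscInvHypersurface.{u} CampaignW31.edgeDataProvenance :=
  campaignW31UscInvHypersurfaceI_iff.mpr fun p _ => campaignW31UscInvHypersurfaceI_of_dictionary p (hdict p)

end Summit.ResolutionOfSingularities.ResolutionOfSingularities.Theorems
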